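import Summits.HodgeConjecture.CorCM.Model.Universe2CupFacts
import Summits.HodgeConjecture.CorCM.Model.WeightDual
import HarnessLib

/-!
# F6 `Fact_weightDual` for the second model universe `Model2.universe₂` (and its three model inputs)

Cell `pub-hodgecm2` (COR-CM), seat model-2 (gen 2).  The stage-1 package DERIVES F6 from `ModelAxioms`, N1, F5 and the
class-M facts `Fact_dimProd`, `Fact_trTopCM`, `Fact_unitH0` (`Universe.weightDual_of_unitH0`, port `StubTree/WeightDualUnit`);
this file proves the three inputs for `universe₂` (twins of `Model/WeightDual.lean`: `rfl`; `Model.tr_top_injective`;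
`bettiOne` + `bettiCohomology.map_one` + `one_cupProduct` + `H⁰ = ℚ · 1`) and feeds the derivation.
-/

noncomputable section

open CategoryTheory
open Literature.AlgebraicGeometry.Motives (bettiCohomology bettiOne bettiCup IsSmoothProjective SchemeOver ComplexPoints)
open Literature.AlgebraicGeometry.Motives
open Literature.AlgebraicTopology.SingularHomology

namespace Summit.HodgeConjecture.CorCM

namespace Model2

open Literature.NumberTheory.Automorphic.PicardCM (BallQuotientUniformisedDatum CMAbelianVarietyRealised)
open Literature.AlgebraicGeometry.HodgeTheory


/-- **`Fact_dimProd`** for `universe₂`: `dim (X × Y) = dim X + dim Y` (by definition of `IsoComplete.Var.dim`). [folklore] -/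
theorem universe₂_fact_dimProd (hHD : exists_isReal_hodgeModel) (hI : hodgePQ_independent_of_hodgeModel)
    (hU : BallQuotientUniformisedDatum) (h₃ : CMAbelianVarietyRealised) : (universe₂ hHD hI hU h₃).Fact_dimProd :=
  fun _ _ ↦ rfl

/-- **`Fact_trTopCM`** for `universe₂`: the top-degree trace of every CM product is injective (`Model.tr_top_injective`
at the smooth projective interpretation). [cite: VoisinHodgeI2002, §5.3.2 Thm. 5.30] -/
theorem universe₂_fact_trTopCM (hHD : exists_isReal_hodgeModel) (hI : hodgePQ_independent_of_hodgeModel)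
    (hU : BallQuotientUniformisedDatum) (h₃ : CMAbelianVarietyRealised) : (universe₂ hHD hI hU h₃).Fact_trTopCM :=
  fun F _ Θ ↦ Model.tr_top_injective (IsoComplete.Var.isSmoothProjective hU h₃ ((universe₂ hHD hI hU h₃).cmProd F Θ))

/-- **`Fact_unitH0`** for `universe₂`: unit classes `1_X = bettiOne X(ℂ)`, natural (`bettiCohomology.map_one`), left units
(`one_cupProduct` through `castCoh`) and spanning `H⁰` of every (path connected) CM product. [cite: HatcherAT2002, §3.2 p. 211] -/
theorem universe₂_fact_unitH0 (hHD : exists_isReal_hodgeModel) (hI : hodgePQ_independent_of_hodgeModel)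
    (hU : BallQuotientUniformisedDatum) (h₃ : CMAbelianVarietyRealised) : (universe₂ hHD hI hU h₃).Fact_unitH0 := by
  refine ⟨fun X ↦ bettiOne (IsoComplete.Var.scheme hU h₃ X), fun X Y f ↦ bettiCohomology.map_one f, fun X l z ↦ ?_,
    fun F n Θ e ↦ ?_⟩
  · apply ((universe₂ hHD hI hU h₃).castCoh X (Nat.zero_add l)).injective
    rw [Model.castCoh_castCoh_symm]
    exact (castCoh_bettiCup hHD hI hU h₃ X rfl (Nat.zero_add l) _ z).trans (one_cupProduct z)
  · haveI := Model.pathConnectedSpace_complexPoints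
      (IsoComplete.Var.isSmoothProjective hU h₃ ((universe₂ hHD hI hU h₃).cmProd F Θ))
    exact Model.exists_eq_smul_bettiOne e

/-- **F6 `Fact_weightDual` for `universe₂`, given its `ModelAxioms`** (the package derivation `weightDual_of_unitH0` fed
with the cell's N1, F5 and the three model facts for `universe₂`). [cite: Pohlmann1968, §1 Thm 1] [cite: VoisinHodgeI2002, §5.3.2 Thm. 5.30] -/
theorem universe₂_fact_weightDual (hHD : exists_isReal_hodgeModel) (hI : hodgePQ_independent_of_hodgeModel)
    (hU : BallQuotientUniformisedDatum) (h₃ : CMAbelianVarietyRealised) (M₂ : (universe₂ hHD hI hU h₃).ModelAxioms) : (universe₂ hHD hI hU h₃).Fact_weightDual :=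
  Universe.weightDual_of_unitH0 M₂ (universe₂_fact_cupExterior hHD hI hU h₃) (universe₂_fact_cupAssoc hHD hI hU h₃)
    (universe₂_fact_dimProd hHD hI hU h₃) (universe₂_fact_trTopCM hHD hI hU h₃) (universe₂_fact_unitH0 hHD hI hU h₃)

end Model2

end Summit.HodgeConjecture.CorCM

end
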